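import Mathlib.Algebra.BigOperators.Ring.Finset
import Mathlib.Algebra.Order.BigOperators.Group.Finset
import Mathlib.Data.Real.Basic
import Mathlib.Tactic.Linarith
import Mathlib.Tactic.Ring
import Mathlib.Tactic.FieldSimp
import HarnessLib

/-!
# One shared coordinate: preliminaries for the three-chain collapse lemma

Support file (prover prim-ineq-prove-3 gen 26; `--supports stmt-CriticalPhenomena-4575`; memo
`run/shared/lean/prim/prim-ineq-prove-3/FINDING-G26-ONE-SHARED-COORDINATE.md` §1).  No definitions, no sorries.

Elementary inequalities for the "three chains, one shared bit" collapse lemma (a shared two-point chain `z ∈ {0,1}` with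
weights `c 0, c 1`, and two private chains with nonnegative, pairwise log-concave weights):
* `lagrange_cov` — the Lagrange / covariance identity `(Σu)(Σ uFG) − (Σ uF)(Σ uG) = Σ_{k<k'} u_k u_{k'} (F_k−F_{k'})(G_k−G_{k'})`;
* `two_by_two_le` — the `2×2` exchange inequality behind Efron's monotonicity for a two-point variable plus a log-concave one;
* `levelMass_le` / `ballMass_le` — mass form of "the ball-conditional mean of an increasing event is nondecreasing in the
  radius" on `{0,1}×{0..J}` (Efron for a Bernoulli and a log-concave variable), stated with cross-multiplied (division-free)
  monotonicity hypotheses;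
* `logConcave_restrict_Ico` — pairwise log-concavity survives restriction to an interval window.
-/

namespace Summit.CriticalPhenomena.PercolationContinuityZ3.Theorems

namespace SahiOneStep

namespace ThreeChain

open Finset

/-- Lagrange's identity in covariance form: for weights `u` and sequences `F, G` on `range n`,
`(Σ u)(Σ u F G) − (Σ u F)(Σ u G) = Σ_k Σ_{k'} [k < k'] u_k u_{k'} (F_k − F_{k'})(G_k − G_{k'})`. [folklore] -/
theorem lagrange_cov (n : ℕ) (u F G : ℕ → ℝ) :
    (∑ k ∈ range n, u k) * (∑ k ∈ range n, u k * F k * G k) - (∑ k ∈ range n, u k * F k) * (∑ k ∈ range n, u k * G k) =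
      ∑ k ∈ range n, ∑ k' ∈ range n, if k < k' then u k * u k' * (F k - F k') * (G k - G k') else 0 := by
  induction n with
  | zero => simp
  | succ n ih =>
    rw [Finset.sum_range_succ, Finset.sum_range_succ, Finset.sum_range_succ, Finset.sum_range_succ,
      Finset.sum_range_succ (fun k => ∑ k' ∈ range (n + 1), _)]
    have hlast : (∑ k' ∈ range (n + 1), if n < k' then u n * u k' * (F n - F k') * (G n - G k') else (0:ℝ)) = 0 :=
      Finset.sum_eq_zero fun k' hk' => by rw [if_neg (by simp at hk'; omega)]
    have hinner : ∀ k ∈ range n, (∑ k' ∈ range (n + 1), if k < k' then u k * u k' * (F k - F k') * (G k - G k') else (0:ℝ)) =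
        (∑ k' ∈ range n, if k < k' then u k * u k' * (F k - F k') * (G k - G k') else 0) +
          u k * u n * (F k - F n) * (G k - G n) := by
      intro k hk
      rw [Finset.sum_range_succ, if_pos (by simp at hk; omega)]
    rw [hlast, add_zero, Finset.sum_congr rfl hinner, Finset.sum_add_distrib, ← ih]
    have e1 : ∑ k ∈ range n, u k * u n * (F k - F n) * (G k - G n) =
        u n * (∑ k ∈ range n, u k * F k * G k) - u n * F n * (∑ k ∈ range n, u k * G k)
          - u n * G n * (∑ k ∈ range n, u k * F k) + u n * F n * G n * (∑ k ∈ range n, u k) := by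
      rw [Finset.mul_sum, Finset.mul_sum, Finset.mul_sum, Finset.mul_sum, ← Finset.sum_sub_distrib,
        ← Finset.sum_sub_distrib, ← Finset.sum_add_distrib]
      exact Finset.sum_congr rfl fun k _ => by ring
    rw [e1]; ring

/-- Sign consequence of `lagrange_cov`: if `u ≥ 0` and `(F_k − F_{k'})(G_k − G_{k'}) ≤ 0` for all `k < k'` in the range, then
`(Σ u)(Σ uFG) ≤ (Σ uF)(Σ uG)` (Chebyshev's sum inequality for oppositely ordered sequences). [folklore] -/
theorem sum_mul_sum_le_of_pairs (n : ℕ) (u F G : ℕ → ℝ) (hu : ∀ k, 0 ≤ u k)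
    (hFG : ∀ k k', k < k' → k' < n → (F k - F k') * (G k - G k') ≤ 0) :
    (∑ k ∈ range n, u k) * (∑ k ∈ range n, u k * F k * G k) ≤ (∑ k ∈ range n, u k * F k) * (∑ k ∈ range n, u k * G k) := by
  have h := lagrange_cov n u F G
  have hneg : (∑ k ∈ range n, ∑ k' ∈ range n, if k < k' then u k * u k' * (F k - F k') * (G k - G k') else (0:ℝ)) ≤ 0 := by
    refine Finset.sum_nonpos fun k hk => Finset.sum_nonpos fun k' hk' => ?_
    split_ifs with hlt
    · have := hFG k k' hlt (by simpa using hk')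
      have huu : 0 ≤ u k * u k' := mul_nonneg (hu k) (hu k')
      nlinarith
    · exact le_rfl
  linarith

/-- Restricting the upper index of the pair sum: the `k < k'` terms with a predicate `W` on both indices. If all pairs inside `W`
have `(F_k−F_{k'})(G_k−G_{k'}) ≥ 0` and all other pairs have it `≤ 0`, then the full pair sum is at most the `W`-pair sum, and the
latter is nonnegative. [this work] -/
theorem pairSum_le_window (n : ℕ) (u F G : ℕ → ℝ) (W : ℕ → Prop) [DecidablePred W] (hu : ∀ k, 0 ≤ u k)
    (hin : ∀ k k', k < k' → k' < n → W k → W k' → 0 ≤ (F k - F k') * (G k - G k'))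
    (hout : ∀ k k', k < k' → k' < n → ¬ (W k ∧ W k') → (F k - F k') * (G k - G k') ≤ 0) :
    ((∑ k ∈ range n, ∑ k' ∈ range n, if k < k' then u k * u k' * (F k - F k') * (G k - G k') else 0) ≤
      ∑ k ∈ range n, ∑ k' ∈ range n, if k < k' ∧ W k ∧ W k' then u k * u k' * (F k - F k') * (G k - G k') else 0) ∧
    0 ≤ ∑ k ∈ range n, ∑ k' ∈ range n, if k < k' ∧ W k ∧ W k' then u k * u k' * (F k - F k') * (G k - G k') else 0 := by
  constructor
  · refine Finset.sum_le_sum fun k hk => Finset.sum_le_sum fun k' hk' => ?_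
    have hk'n : k' < n := by simpa using hk'
    by_cases hlt : k < k'
    · by_cases hW : W k ∧ W k'
      · rw [if_pos hlt, if_pos ⟨hlt, hW⟩]
      · rw [if_pos hlt, if_neg (fun h => hW h.2)]
        have := hout k k' hlt hk'n hW
        have huu : 0 ≤ u k * u k' := mul_nonneg (hu k) (hu k')
        nlinarith
    · rw [if_neg hlt, if_neg (fun h => hlt h.1)]
  · refine Finset.sum_nonneg fun k hk => Finset.sum_nonneg fun k' hk' => ?_
    split_ifs with h
    · have := hin k k' h.1 (by simpa using hk') h.2.1 h.2.2
      have huu : 0 ≤ u k * u k' := mul_nonneg (hu k) (hu k')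
      nlinarith
    · exact le_rfl

/-- The `2 × 2` exchange inequality (mass form of Efron's two-variable monotonicity step): for nonnegative reals with
`x₀ y₀' ≤ x₀' y₀`, `x₁ y₁' ≤ x₁' y₁`, `x₀ y₁' ≤ x₁' y₀`, the log-concavity relation `y₁ y₀' ≤ y₀ y₁'` and `x₁ ≤ y₁`:
`(c₀x₀ + c₁x₁)(c₀y₀' + c₁y₁') ≤ (c₀x₀' + c₁x₁')(c₀y₀ + c₁y₁)`. [this work] -/
theorem two_by_two_le (c₀ c₁ x₀ x₁ y₀ y₁ x₀' x₁' y₀' y₁' : ℝ) (hc₀ : 0 ≤ c₀) (hc₁ : 0 ≤ c₁)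
    (hx₁ : 0 ≤ x₁) (hy₀ : 0 ≤ y₀) (hy₁ : 0 ≤ y₁) (hx₀' : 0 ≤ x₀') (hy₀' : 0 ≤ y₀') (hy₁' : 0 ≤ y₁')
    (f1 : x₀ * y₀' ≤ x₀' * y₀) (f2 : x₁ * y₁' ≤ x₁' * y₁) (f3 : x₀ * y₁' ≤ x₁' * y₀) (f4 : y₁ * y₀' ≤ y₀ * y₁') (f6 : x₁ ≤ y₁) :
    (c₀ * x₀ + c₁ * x₁) * (c₀ * y₀' + c₁ * y₁') ≤ (c₀ * x₀' + c₁ * x₁') * (c₀ * y₀ + c₁ * y₁) := by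
  -- the cross term `T = (x₀y₁' − x₁'y₀) + X`, `X = x₁y₀' − x₀'y₁`
  have key : x₀ * y₁' + x₁ * y₀' ≤ x₁' * y₀ + x₀' * y₁ := by
    by_cases hX : x₁ * y₀' ≤ x₀' * y₁
    · linarith
    · push Not at hX
      -- here `x₁ > 0`, hence `y₁ > 0`, and `y₀' > 0`
      have hx₁pos : 0 < x₁ := by
        rcases hx₁.eq_or_lt with h | h
        · rw [← h, zero_mul] at hX; exact absurd hX (not_lt.2 (mul_nonneg hx₀' hy₁))
        · exact h
      have hy₁pos : 0 < y₁ := lt_of_lt_of_le hx₁pos f6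
      have hy₀'pos : 0 < y₀' := by
        rcases hy₀'.eq_or_lt with h | h
        · rw [← h, mul_zero] at hX; exact absurd hX (not_lt.2 (mul_nonneg hx₀' hy₁))
        · exact h
      have hprod : 0 < y₁ * y₀' := mul_pos hy₁pos hy₀'pos
      -- multiply the target by `y₁ y₀' > 0`
      have hmul : (x₀ * y₁' + x₁ * y₀' - x₁' * y₀ - x₀' * y₁) * (y₁ * y₀') ≤ 0 := by
        have hXpos : 0 ≤ x₁ * y₀' - x₀' * y₁ := by linarith
        have step : (x₁ * y₀' - x₀' * y₁) * (y₁ * y₀') ≤ (x₁ * y₀' - x₀' * y₁) * (y₀ * y₁') :=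
          mul_le_mul_of_nonneg_left f4 hXpos
        have g1 : y₁ * y₁' * (x₀ * y₀' - x₀' * y₀) ≤ 0 :=
          mul_nonpos_of_nonneg_of_nonpos (mul_nonneg hy₁ hy₁') (by linarith)
        have g2 : y₀ * y₀' * (x₁ * y₁' - x₁' * y₁) ≤ 0 :=
          mul_nonpos_of_nonneg_of_nonpos (mul_nonneg hy₀ hy₀') (by linarith)
        nlinarith
      by_contra hcon
      push Not at hcon
      have : 0 < (x₀ * y₁' + x₁ * y₀' - x₁' * y₀ - x₀' * y₁) * (y₁ * y₀') := mul_pos (by linarith) hprod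
      linarith
  have t1 : c₀ * c₀ * (x₀ * y₀' - x₀' * y₀) ≤ 0 := mul_nonpos_of_nonneg_of_nonpos (mul_nonneg hc₀ hc₀) (by linarith)
  have t2 : c₁ * c₁ * (x₁ * y₁' - x₁' * y₁) ≤ 0 := mul_nonpos_of_nonneg_of_nonpos (mul_nonneg hc₁ hc₁) (by linarith)
  have t3 : c₀ * c₁ * (x₀ * y₁' + x₁ * y₀' - x₁' * y₀ - x₀' * y₁) ≤ 0 :=
    mul_nonpos_of_nonneg_of_nonpos (mul_nonneg hc₀ hc₁) (by linarith)
  nlinarith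

/-! ## Efron's monotonicity for a two-point variable and a log-concave chain (mass form) -/

/-- Splitting off the top level of a simplex ball on `{0,1}×{0..J}`: `[z+j < r+1] = [z+j < r] + [z+j = r]`. [folklore] -/
theorem ballSum_succ (J r : ℕ) (w : ℕ → ℕ → ℝ) :
    (∑ z ∈ range 2, ∑ j ∈ range (J + 1), if z + j < r + 1 then w z j else 0) =
      (∑ z ∈ range 2, ∑ j ∈ range (J + 1), if z + j < r then w z j else 0) +
        ∑ z ∈ range 2, ∑ j ∈ range (J + 1), if z + j = r then w z j else 0 := by
  rw [← Finset.sum_add_distrib]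
  refine Finset.sum_congr rfl fun z _ => ?_
  rw [← Finset.sum_add_distrib]
  refine Finset.sum_congr rfl fun j _ => ?_
  by_cases h1 : z + j < r
  · rw [if_pos (by omega), if_pos h1, if_neg (by omega), add_zero]
  · by_cases h2 : z + j = r
    · rw [if_pos (by omega), if_neg h1, if_pos h2, zero_add]
    · rw [if_neg (by omega), if_neg h1, if_neg h2, add_zero]

/-- A simplex ball is the sum of its levels: `Σ [z+j < r] w = Σ_{v<r} Σ [z+j = v] w`. [folklore] -/
theorem ballSum_eq_sum_levels (J r : ℕ) (w : ℕ → ℕ → ℝ) :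
    (∑ z ∈ range 2, ∑ j ∈ range (J + 1), if z + j < r then w z j else 0) =
      ∑ v ∈ range r, ∑ z ∈ range 2, ∑ j ∈ range (J + 1), if z + j = v then w z j else 0 := by
  induction r with
  | zero =>
    rw [Finset.sum_range_zero]
    exact Finset.sum_eq_zero fun z _ => Finset.sum_eq_zero fun j _ => by rw [if_neg (by omega)]
  | succ r ih => rw [ballSum_succ, ih]; conv_rhs => rw [Finset.sum_range_succ]

/-- The level `{z + j = v}` of `{0,1}×{0..J}` has at most two cells: for `w` vanishing at `j > J`,
`Σ [z+j = v] w z j = w 0 v + (v ≠ 0 ? w 1 (v−1) : 0)`. [folklore] -/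
theorem levelSum_two (J v : ℕ) (w : ℕ → ℕ → ℝ) (hw : ∀ z j, J < j → w z j = 0) :
    (∑ z ∈ range 2, ∑ j ∈ range (J + 1), if z + j = v then w z j else 0) =
      w 0 v + (if v = 0 then 0 else w 1 (v - 1)) := by
  rw [Finset.sum_range_succ, Finset.sum_range_succ, Finset.sum_range_zero, zero_add]
  have h0 : (∑ j ∈ range (J + 1), if 0 + j = v then w 0 j else 0) = w 0 v := by
    by_cases hv : v ≤ J
    · rw [Finset.sum_eq_single v]
      · rw [if_pos (by omega)]
      · intro j _ hj; rw [if_neg (by omega)]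
      · intro hv'; exact absurd (Finset.mem_range.2 (by omega)) hv'
    · rw [hw 0 v (by omega)]
      exact Finset.sum_eq_zero fun j hj => by
        have := Finset.mem_range.1 hj
        rw [if_neg (by omega)]
  have h1 : (∑ j ∈ range (J + 1), if 1 + j = v then w 1 j else 0) = if v = 0 then 0 else w 1 (v - 1) := by
    by_cases hv0 : v = 0
    · rw [if_pos hv0]
      exact Finset.sum_eq_zero fun j _ => by rw [if_neg (by omega)]
    · rw [if_neg hv0]
      by_cases hv : v - 1 ≤ J
      · rw [Finset.sum_eq_single (v - 1)]
        · rw [if_pos (by omega)]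
        · intro j _ hj; rw [if_neg (by omega)]
        · intro hv'; exact absurd (Finset.mem_range.2 (by omega)) hv'
      · rw [hw 1 (v - 1) (by omega)]
        exact Finset.sum_eq_zero fun j hj => by
          have := Finset.mem_range.1 hj
          rw [if_neg (by omega)]
  rw [h0, h1]

/-- **Level monotonicity (Efron, two-point × log-concave, mass form).**  For weights `c 0, c 1 ≥ 0` on the bit, nonnegative
pairwise log-concave weights `b` on the chain (vanishing beyond `J`), and layer masses `β z j ≤ b j` of an event increasing in both
coordinates (cross-monotone in `j`, monotone in `z`), the level masses `m_v = Σ_{z+j=v} c_z b_j`, `s_v = Σ_{z+j=v} c_z β_{z,j}`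
satisfy `s_v m_{v'} ≤ s_{v'} m_v` for `v ≤ v'` (the level-conditional mean is nondecreasing in the level). [this work] -/
theorem levelMass_le (J : ℕ) (c b : ℕ → ℝ) (β : ℕ → ℕ → ℝ) (hc : ∀ z, 0 ≤ c z) (hb : ∀ j, 0 ≤ b j)
    (hbJ : ∀ j, J < j → b j = 0) (hblc : ∀ i j, i < j → b i * b (j + 1) ≤ b (i + 1) * b j)
    (hβ0 : ∀ z j, 0 ≤ β z j) (hβb : ∀ z j, β z j ≤ b j) (hβz : ∀ j, β 0 j ≤ β 1 j)
    (hβj : ∀ z j j', j ≤ j' → β z j * b j' ≤ β z j' * b j) {v v' : ℕ} (hvv' : v ≤ v') :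
    (∑ z ∈ range 2, ∑ j ∈ range (J + 1), if z + j = v then c z * β z j else 0) *
        (∑ z ∈ range 2, ∑ j ∈ range (J + 1), if z + j = v' then c z * b j else 0) ≤
      (∑ z ∈ range 2, ∑ j ∈ range (J + 1), if z + j = v' then c z * β z j else 0) *
        (∑ z ∈ range 2, ∑ j ∈ range (J + 1), if z + j = v then c z * b j else 0) := by
  have hβJ : ∀ z j, J < j → β z j = 0 := fun z j hj => le_antisymm ((hβb z j).trans (hbJ j hj).le) (hβ0 z j)
  rw [levelSum_two J v (fun z j => c z * β z j) (fun z j hj => by simp [hβJ z j hj]),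
    levelSum_two J v' (fun z j => c z * b j) (fun z j hj => by simp [hbJ j hj]),
    levelSum_two J v' (fun z j => c z * β z j) (fun z j hj => by simp [hβJ z j hj]),
    levelSum_two J v (fun z j => c z * b j) (fun z j hj => by simp [hbJ j hj])]
  rcases hvv'.eq_or_lt with heq | hlt
  · rw [heq]
  -- `v < v'`, in particular `v' ≠ 0`
  have hv'0 : v' ≠ 0 := by omega
  rw [if_neg hv'0, if_neg hv'0]
  -- the data of `two_by_two_le`
  set x₁ : ℝ := if v = 0 then 0 else β 1 (v - 1) with hx₁
  set y₁ : ℝ := if v = 0 then 0 else b (v - 1) with hy₁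
  have ex : (if v = 0 then (0:ℝ) else c 1 * β 1 (v - 1)) = c 1 * x₁ := by
    simp only [hx₁]; split_ifs <;> simp
  have ey : (if v = 0 then (0:ℝ) else c 1 * b (v - 1)) = c 1 * y₁ := by
    simp only [hy₁]; split_ifs <;> simp
  rw [ex, ey]
  have hx₁0 : 0 ≤ x₁ := by simp only [hx₁]; split_ifs; exacts [le_rfl, hβ0 _ _]
  have hy₁0 : 0 ≤ y₁ := by simp only [hy₁]; split_ifs; exacts [le_rfl, hb _]
  have f2 : x₁ * b (v' - 1) ≤ β 1 (v' - 1) * y₁ := by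
    simp only [hx₁, hy₁]
    split_ifs with hv0
    · rw [zero_mul, mul_zero]
    · exact hβj 1 (v - 1) (v' - 1) (by omega)
  have f4 : y₁ * b v' ≤ b v * b (v' - 1) := by
    simp only [hy₁]
    split_ifs with hv0
    · rw [zero_mul]; exact mul_nonneg (hb _) (hb _)
    · have h := hblc (v - 1) (v' - 1) (by omega)
      have e1 : v - 1 + 1 = v := by omega
      have e2 : v' - 1 + 1 = v' := by omega
      rw [e1, e2] at h
      exact h
  have f6 : x₁ ≤ y₁ := by simp only [hx₁, hy₁]; split_ifs; exacts [le_rfl, hβb _ _]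
  have f1 : β 0 v * b v' ≤ β 0 v' * b v := hβj 0 v v' hvv'
  have f3 : β 0 v * b (v' - 1) ≤ β 1 (v' - 1) * b v :=
    (hβj 0 v (v' - 1) (by omega)).trans (mul_le_mul_of_nonneg_right (hβz _) (hb _))
  exact two_by_two_le (c 0) (c 1) (β 0 v) x₁ (b v) y₁ (β 0 v') (β 1 (v' - 1)) (b v') (b (v' - 1))
    (hc 0) (hc 1) hx₁0 (hb v) hy₁0 (hβ0 0 v') (hb v') (hb (v' - 1)) f1 f2 f3 f4 f6

/-- **Ball monotonicity (mass form).**  Under the hypotheses of `levelMass_le`, with `P(r) = Σ [z+j<r] c_z b_j` and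
`Q(r) = Σ [z+j<r] c_z β_{z,j}`: `Q(r)·P(r') ≤ Q(r')·P(r)` for `r ≤ r'` — the ball-conditional mass fraction of the increasing event is
nondecreasing in the radius. [this work] -/
theorem ballMass_le (J : ℕ) (c b : ℕ → ℝ) (β : ℕ → ℕ → ℝ) (hc : ∀ z, 0 ≤ c z) (hb : ∀ j, 0 ≤ b j)
    (hbJ : ∀ j, J < j → b j = 0) (hblc : ∀ i j, i < j → b i * b (j + 1) ≤ b (i + 1) * b j)
    (hβ0 : ∀ z j, 0 ≤ β z j) (hβb : ∀ z j, β z j ≤ b j) (hβz : ∀ j, β 0 j ≤ β 1 j)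
    (hβj : ∀ z j j', j ≤ j' → β z j * b j' ≤ β z j' * b j) {r r' : ℕ} (hrr' : r ≤ r') :
    (∑ z ∈ range 2, ∑ j ∈ range (J + 1), if z + j < r then c z * β z j else 0) *
        (∑ z ∈ range 2, ∑ j ∈ range (J + 1), if z + j < r' then c z * b j else 0) ≤
      (∑ z ∈ range 2, ∑ j ∈ range (J + 1), if z + j < r' then c z * β z j else 0) *
        (∑ z ∈ range 2, ∑ j ∈ range (J + 1), if z + j < r then c z * b j else 0) := by
  have hlev : ∀ v v', v ≤ v' →
      (∑ z ∈ range 2, ∑ j ∈ range (J + 1), if z + j = v then c z * β z j else 0) *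
          (∑ z ∈ range 2, ∑ j ∈ range (J + 1), if z + j = v' then c z * b j else 0) ≤
        (∑ z ∈ range 2, ∑ j ∈ range (J + 1), if z + j = v' then c z * β z j else 0) *
          (∑ z ∈ range 2, ∑ j ∈ range (J + 1), if z + j = v then c z * b j else 0) := fun v v' hvv' =>
    levelMass_le J c b β hc hb hbJ hblc hβ0 hβb hβz hβj hvv'
  induction r' with
  | zero =>
    have hr : r = 0 := by omega
    subst hr; exact le_rfl
  | succ r' ih =>
    rcases Nat.lt_or_ge r' r with hlt | hge
    · have : r = r' + 1 := by omega
      subst this; exact le_rfl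
    · have ih' := ih hge
      have eP := ballSum_succ J r' (fun z j => c z * b j)
      have eQ := ballSum_succ J r' (fun z j => c z * β z j)
      rw [eP, eQ]
      have hQ : (∑ z ∈ range 2, ∑ j ∈ range (J + 1), if z + j < r then c z * β z j else 0) =
          ∑ v ∈ range r, ∑ z ∈ range 2, ∑ j ∈ range (J + 1), if z + j = v then c z * β z j else 0 :=
        ballSum_eq_sum_levels J r _
      have hP : (∑ z ∈ range 2, ∑ j ∈ range (J + 1), if z + j < r then c z * b j else 0) =
          ∑ v ∈ range r, ∑ z ∈ range 2, ∑ j ∈ range (J + 1), if z + j = v then c z * b j else 0 :=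
        ballSum_eq_sum_levels J r _
      have key : (∑ z ∈ range 2, ∑ j ∈ range (J + 1), if z + j < r then c z * β z j else 0) *
            (∑ z ∈ range 2, ∑ j ∈ range (J + 1), if z + j = r' then c z * b j else 0) ≤
          (∑ z ∈ range 2, ∑ j ∈ range (J + 1), if z + j = r' then c z * β z j else 0) *
            (∑ z ∈ range 2, ∑ j ∈ range (J + 1), if z + j < r then c z * b j else 0) := by
        rw [hQ, hP, Finset.sum_mul, Finset.mul_sum]
        exact Finset.sum_le_sum fun v hv => hlev v r' (by have := Finset.mem_range.1 hv; omega)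
      nlinarith [key, ih']

/-! ## Small helpers: window restriction of log-concave weights, a triple-sum commutation -/

/-- Pairwise log-concavity (no internal zeros) survives restriction to an interval window `[θ₁, θ₀)`. [folklore] -/
theorem logConcave_restrict (a : ℕ → ℝ) (ha : ∀ k, 0 ≤ a k) (halc : ∀ i j, i < j → a i * a (j + 1) ≤ a (i + 1) * a j)
    (θ₀ θ₁ : ℕ) :
    ∀ i j, i < j → (if θ₁ ≤ i ∧ i < θ₀ then a i else 0) * (if θ₁ ≤ j + 1 ∧ j + 1 < θ₀ then a (j + 1) else 0) ≤
      (if θ₁ ≤ i + 1 ∧ i + 1 < θ₀ then a (i + 1) else 0) * (if θ₁ ≤ j ∧ j < θ₀ then a j else 0) := by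
  intro i j hij
  by_cases hi : θ₁ ≤ i ∧ i < θ₀
  · by_cases hj : θ₁ ≤ j + 1 ∧ j + 1 < θ₀
    · rw [if_pos hi, if_pos hj, if_pos (by omega), if_pos (by omega)]
      exact halc i j hij
    · rw [if_neg hj, mul_zero]
      exact mul_nonneg (by split_ifs; exacts [ha _, le_rfl]) (by split_ifs; exacts [ha _, le_rfl])
  · rw [if_neg hi, zero_mul]
    exact mul_nonneg (by split_ifs; exacts [ha _, le_rfl]) (by split_ifs; exacts [ha _, le_rfl])

/-- Commuting the two outer sums of a triple sum. [folklore] -/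
theorem sum3_comm {f : ℕ → ℕ → ℕ → ℝ} (S T U : Finset ℕ) :
    (∑ z ∈ S, ∑ k ∈ T, ∑ j ∈ U, f z k j) = ∑ k ∈ T, ∑ z ∈ S, ∑ j ∈ U, f z k j :=
  Finset.sum_comm

/-- The ball masses `ℓ_k = Σ [z+k+j<t] c_z b_j` are nonincreasing in `k`. [folklore] -/
theorem ballMass_antitone (J t : ℕ) (c b : ℕ → ℝ) (hc : ∀ z, 0 ≤ c z) (hb : ∀ j, 0 ≤ b j) {k k' : ℕ} (hkk' : k ≤ k') :
    (∑ z ∈ range 2, ∑ j ∈ range (J + 1), if z + k' + j < t then c z * b j else 0) ≤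
      ∑ z ∈ range 2, ∑ j ∈ range (J + 1), if z + k + j < t then c z * b j else 0 := by
  refine Finset.sum_le_sum fun z _ => Finset.sum_le_sum fun j _ => ?_
  by_cases h : z + k' + j < t
  · rw [if_pos h, if_pos (by omega)]
  · rw [if_neg h]; split_ifs; exacts [mul_nonneg (hc z) (hb j), le_rfl]

/-- A ball sum of a sub-mass is at most the ball mass: `0 ≤ w ≤ c⊗b` cellwise gives `Σ [P] w ≤ Σ [P] c b`. [folklore] -/
theorem ballSum_le_ballMass (J : ℕ) (P : ℕ → ℕ → Prop) [∀ z j, Decidable (P z j)] (c b : ℕ → ℝ) (w : ℕ → ℕ → ℝ)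
    (hw : ∀ z j, w z j ≤ c z * b j) :
    (∑ z ∈ range 2, ∑ j ∈ range (J + 1), if P z j then w z j else 0) ≤
      ∑ z ∈ range 2, ∑ j ∈ range (J + 1), if P z j then c z * b j else 0 :=
  Finset.sum_le_sum fun z _ => Finset.sum_le_sum fun j _ => by split_ifs; exacts [hw z j, le_rfl]

/-- Nonnegativity of an `if`-sum with nonnegative cells. [folklore] -/
theorem ballSum_nonneg (J : ℕ) (P : ℕ → ℕ → Prop) [∀ z j, Decidable (P z j)] (w : ℕ → ℕ → ℝ) (hw : ∀ z j, 0 ≤ w z j) :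
    0 ≤ ∑ z ∈ range 2, ∑ j ∈ range (J + 1), if P z j then w z j else 0 :=
  Finset.sum_nonneg fun z _ => Finset.sum_nonneg fun j _ => by split_ifs; exacts [hw z j, le_rfl]

end ThreeChain

end SahiOneStep

end Summit.CriticalPhenomena.PercolationContinuityZ3.Theorems
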